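import Summits.QuantumFields.YangMills.Theorems.BalabanUVNodesN14ConvexFibreEngine
import Summits.QuantumFields.YangMills.Theorems.BalabanUVNodesN14VarianceSocket
import Summits.QuantumFields.BalabanUV.T4Continuum.Spine.NE7b.ConvexTiltSuppliers
import Literature.MathematicalPhysics.QuantumFieldTheory.Balaban1983to89.B1Eq357FluctuationPolynomial

/-!
# BalabanUVNodes ∕ node N14 = NE1′ — THE CONVEX-FIBRE ENGINE ON THE SOURCE WINDOW: tilt stability of the modulus, the variance
# socket's letter from the modulus, and THE TOWER IN HERBST CURRENCY (conditionally sub-Gaussian born increments ⇒ K-uniform cumulant)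

Cell `pub-ymgap`, HUMAN RULING D-0062 (Track A at full width), seat `pub-ymgap-dag-n14-c` (R134 ACCELERATION, strategy s1), generation 4;
route `Summits/QuantumFields/YangMills/Theses/BalabanUVNodes.lean` (cluster K3′ `SpineGivenEndpointR12`, `--supports … --as helper`); venue
ruling R424 (`YangMills/Theorems`, namespace `YMDAG.N14.ConvexFibreWindow`).  Sequel of `…N14ConvexFibreEngine` (the schema ∕ Herbst ∕
Brascamp–Lieb engine of ONE uniformly log-concave fibre).  ADDITIVE — imports that file, generation 3's `…N14VarianceSocket`
(`tiltedMeanMatching_of_variance`), the NE7b convexity road's supplier `Spine/NE7b/ConvexTiltSuppliers` (`firstOrder_add`, CITED) and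
`Literature/…/B1Eq357FluctuationPolynomial` (`hasSubgaussianMGF_mono`, CITED per dag-lead DEDUP-224); THEOREMS ONLY (0 `def`), modifies nothing.

WHAT THIS IS.
* §1 TILT STABILITY OF THE MODULUS [folklore]: `V` differentiable and `λ`-uniformly convex (first-order letter), `G` differentiable with
  the TWO-SIDED first-order letter of constant `M` (semiconvex and semiconcave: `|G y − G x − ⟪∇G x, y − x⟫| ≤ (M∕2)‖y − x‖²`),
  `|s| ≤ l₀` ⇒ the source-tilted action `V − s·G` is `(λ − l₀M)`-uniformly convex (`firstOrder_sub_mul`, by `ConvexTiltSuppliers.firstOrder_add`);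
  with `tilted_mul_eq`: `(e^{−V}dx∕Z).tilted (s·G) = e^{−(V − s·G)}dx∕Z′` (Mathlib `tilted_tilted`).
* §2 ON THE WINDOW `|s| ≤ l₀`, `l₀M < λ` (the engine at modulus `λ − l₀M` for the TILTED law `ν_s = ν.tilted (s·G)`):
  `entropyC1c_tilted_of_uniformlyConvex` (the schema for `ν_s`, `C = 1∕(λ − l₀M)`), `hasSubgaussianMGF_tilted_of_uniformlyConvex` (any
  bounded `C¹` observable `F` under `ν_s`, parameter `L_F²∕(λ − l₀M)`), **`variance_tilted_le_of_uniformlyConvex`**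
  (`Var[G; ν.tilted (s·G)] ≤ (λ − l₀M)⁻¹·L²` — the VARIANCE SOCKET'S letter VERBATIM, `…N14VarianceSocket.tiltedMeanMatching_of_variance`),
  `iteratedDeriv_two_cgf_le_of_uniformlyConvex` (`cgf″ ≤ (λ − l₀M)⁻¹·L²` on the window, Mathlib `variance_tilted_mul`).
* §3 THE SOCKET PLUG: `tiltedMeanMatching_of_variance_le` (abstract: zero-tilt matching `η₀` + both runs' tilted variances `≤ v K` on the
  window ⇒ `TiltedMeanMatching … (η₀ + l₀·v)`).  HONEST: a modulus ALONE gives `v K = (λ − l₀M)⁻¹·(L K)²` — BOUNDED, and summable only if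
  the fibre-gradient sizes `L K` of the dressed totals are square-summable, which for the tower of record they are NOT (the young scales
  carry `O(1)` gradient): the socket's MATCHING `|Var′ − Var| → 0` needs the per-bond engine `CovGradBound` with a decaying kernel
  (Helffer–Sjöstrand, located) or NODE O's decoupling; what the modulus pays summably is §4.
* §4 THE TOWER IN HERBST CURRENCY [folklore ∘ Mathlib `HasSubgaussianMGF.sum_of_hasCondSubgaussianMGF` (the Azuma structure)]: along a
  filtration, born increments `Y k` CONDITIONALLY sub-Gaussian with parameters `c_k ≤ a·θ^{2k}`, `θ < 1` ⇒ the dressed total's centred sum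
  `Σ_{k<K} Y k` is sub-Gaussian with parameter `a∕(1 − θ²)` for EVERY `K` (`hasSubgaussianMGF_sum_geometric`), hence
  **`bornCumulant_le_of_tower`**: `cgf F μ t − t·∫F dμ ≤ (a∕(1 − θ²))·t²∕2`, K-UNIFORM — dressed stability of the COUPLED tower in Herbst
  currency, the per-fibre `c_k = (L₀θ₁^k)²∕λ′` being `…ConvexFibreEngine.hasSubgaussianMGF_of_uniformlyConvex`'s output fibre by fibre.

WHAT THIS IS NOT.  Everything here is PROVED (0 `sorry`, 0 named-fact hypotheses).  HYPOTHESES in any application: the uniform convexity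
of Bałaban's history-conditioned small-field fibre actions stably under the tilt (NODE O's located positivity statement) and, for §4, the
CONDITIONAL sub-Gaussianity of the born increments along the RG filtration (what fibrewise convexity + fibre-gradient `θ₁^k` would give).
Nothing of Bałaban's instantiated; N14 NOT discharged; `TiltedMeanMatching` instantiated on NO law of record; count-neutral.  One finite
four-torus programme at fixed ε; NOT ℝ⁴, NOT OS, NOT a mass gap, NOT Clay.
-/

noncomputable section

namespace YMDAG.N14.ConvexFibreWindow

open MeasureTheory ProbabilityTheory Set Filter Topology InnerProductSpace Finset
open scoped RealInnerProductSpace ENNReal NNReal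
open Literature.Analysis.FunctionSpaces (isProbabilityMeasure_tilted_neg)
open Literature.MathematicalPhysics.QuantumFieldTheory.Balaban1983to89.B1Eq357FluctuationPolynomial (hasSubgaussianMGF_mono)
open Summit.QuantumFields.BalabanUV.T4Continuum.NE7b.ConvexTiltSuppliers (firstOrder_add hasGradientAt_of_hasFDerivAt_toDual)
open Summit.QuantumFields.BalabanUV.T4Continuum.NE1p.DressedMGFForm (tiltedMean TiltedMeanMatching)
open YMDAG.N14.CovGradEngine (bornCumulant_le_of_hasSubgaussianMGF)
open YMDAG.N14.ConvexFibreEngine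

variable {n : ℕ}

/-! ## §1 Tilt stability: `V − s·G` keeps a modulus `λ − l₀M` on the source window `|s| ≤ l₀` -/
section Tilt

/-- The gradient of `x ↦ c·G x` is `c • ∇G x` for differentiable `G` (Euclidean carrier). [folklore] -/
theorem gradient_const_mul_euclidean {G : EuclideanSpace ℝ (Fin n) → ℝ} (hG : Differentiable ℝ G) (c : ℝ) (x : EuclideanSpace ℝ (Fin n)) :
    gradient (fun z => c * G z) x = c • gradient G x := by
  have e := (hG x).hasGradientAt
  rw [hasGradientAt_iff_hasFDerivAt] at e
  have e' := e.const_mul c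
  rw [← map_smul] at e'
  exact (hasGradientAt_of_hasFDerivAt_toDual e').gradient

/-- The semiconvexity letter of `−s·G` from the two-sided first-order letter of `G`: if `G` is semiconvex and semiconcave with constant
`M` and `|s| ≤ l₀`, then `x ↦ −s·G x` has first-order modulus `−l₀M`. [folklore] -/
theorem firstOrder_neg_mul {G : EuclideanSpace ℝ (Fin n) → ℝ} {M l₀ s : ℝ} (hG : Differentiable ℝ G)
    (hGlo : ∀ x y : EuclideanSpace ℝ (Fin n), G x + ⟪gradient G x, y - x⟫ - M / 2 * ‖y - x‖ ^ 2 ≤ G y)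
    (hGup : ∀ x y : EuclideanSpace ℝ (Fin n), G y ≤ G x + ⟪gradient G x, y - x⟫ + M / 2 * ‖y - x‖ ^ 2) (hs : |s| ≤ l₀)
    (x y : EuclideanSpace ℝ (Fin n)) :
    (-s * G x) + ⟪gradient (fun z => -s * G z) x, y - x⟫ + (-(l₀ * M)) / 2 * ‖y - x‖ ^ 2 ≤ -s * G y := by
  rw [gradient_const_mul_euclidean hG, inner_smul_left]
  simp only [conj_trivial]
  have h1 := hGlo x y
  have h2 := hGup x y
  have hl₀ : 0 ≤ l₀ := (abs_nonneg s).trans hs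
  have key : s * (G y - G x - ⟪gradient G x, y - x⟫) ≤ l₀ * (M / 2 * ‖y - x‖ ^ 2) := by
    have hab : |G y - G x - ⟪gradient G x, y - x⟫| ≤ M / 2 * ‖y - x‖ ^ 2 := abs_le.2 ⟨by linarith, by linarith⟩
    calc s * (G y - G x - ⟪gradient G x, y - x⟫) ≤ |s * (G y - G x - ⟪gradient G x, y - x⟫)| := le_abs_self _
      _ = |s| * |G y - G x - ⟪gradient G x, y - x⟫| := abs_mul _ _
      _ ≤ l₀ * (M / 2 * ‖y - x‖ ^ 2) := mul_le_mul hs hab (abs_nonneg _) hl₀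
  nlinarith [key]

/-- **TILT STABILITY OF THE MODULUS** [folklore].  `V` differentiable and `λ`-uniformly convex (first-order letter), `G` differentiable
with the two-sided first-order letter of constant `M`, `|s| ≤ l₀`: the source-tilted action `V − s·G` is `(λ − l₀M)`-uniformly convex
in the same letter (the NE7b supplier `ConvexTiltSuppliers.firstOrder_add`: first-order moduli add, any signs).  For Bałaban's fibres:
convexity of the small-field action survives an observable source of size `l₀` as long as `l₀·M < λ`. -/
theorem firstOrder_sub_mul {V G : EuclideanSpace ℝ (Fin n) → ℝ} {lam M l₀ s : ℝ} (hVd : Differentiable ℝ V) (hGd : Differentiable ℝ G)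
    (hV : ∀ x y : EuclideanSpace ℝ (Fin n), V x + ⟪gradient V x, y - x⟫ + lam / 2 * ‖y - x‖ ^ 2 ≤ V y)
    (hGlo : ∀ x y : EuclideanSpace ℝ (Fin n), G x + ⟪gradient G x, y - x⟫ - M / 2 * ‖y - x‖ ^ 2 ≤ G y)
    (hGup : ∀ x y : EuclideanSpace ℝ (Fin n), G y ≤ G x + ⟪gradient G x, y - x⟫ + M / 2 * ‖y - x‖ ^ 2) (hs : |s| ≤ l₀)
    (x y : EuclideanSpace ℝ (Fin n)) :
    (V x - s * G x) + ⟪gradient (fun z => V z - s * G z) x, y - x⟫ + (lam - l₀ * M) / 2 * ‖y - x‖ ^ 2 ≤ V y - s * G y := by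
  have h := firstOrder_add (l₁ := lam) (l₂ := -(l₀ * M)) hVd (hGd.const_mul (-s)) hV (firstOrder_neg_mul hGd hGlo hGup hs) x y
  have e1 : (fun z => V z + -s * G z) = fun z => V z - s * G z := by funext z; ring
  rw [e1, show lam + -(l₀ * M) = lam - l₀ * M by ring, show V x + -s * G x = V x - s * G x by ring,
    show V y + -s * G y = V y - s * G y by ring] at h
  exact h

/-- `e^{−(V − sG)}` is integrable when `e^{−V}` is and `G` is bounded: `e^{−V + sG} ≤ e^{|s|B}·e^{−V}`. [folklore] -/
theorem integrable_exp_neg_sub_mul {V G : EuclideanSpace ℝ (Fin n) → ℝ} {B : ℝ} (hVc : Continuous V) (hGc : Continuous G)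
    (hGb : ∀ x, |G x| ≤ B) (hZ : Integrable fun x => Real.exp (-V x)) (s : ℝ) :
    Integrable fun x => Real.exp (-(V x - s * G x)) := by
  refine (hZ.const_mul (Real.exp (|s| * B))).mono'
    (Real.continuous_exp.comp (hVc.sub (continuous_const.mul hGc)).neg).aestronglyMeasurable (Eventually.of_forall fun x => ?_)
  rw [Real.norm_eq_abs, abs_of_pos (Real.exp_pos _), ← Real.exp_add, Real.exp_le_exp]
  have h : s * G x ≤ |s| * B := by
    calc s * G x ≤ |s * G x| := le_abs_self _
      _ = |s| * |G x| := abs_mul _ _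
      _ ≤ |s| * B := mul_le_mul_of_nonneg_left (hGb x) (abs_nonneg _)
  linarith

/-- **THE SOURCE-TILTED FIBRE LAW IS A UNIFORMLY LOG-CONCAVE LAW** [folklore]: `(e^{−V}dx∕Z).tilted (s·G) = e^{−(V − s·G)}dx∕Z′`
(Mathlib `tilted_tilted`) — the tilted law `ν_s` of the variance socket in the setting of `…ConvexFibreEngine` with modulus `λ − l₀M`. -/
theorem tilted_mul_eq {V G : EuclideanSpace ℝ (Fin n) → ℝ} (hZ : Integrable fun x => Real.exp (-V x)) (s : ℝ) :
    ((volume : Measure (EuclideanSpace ℝ (Fin n))).tilted fun x => -V x).tilted (fun x => s * G x) =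
      (volume : Measure (EuclideanSpace ℝ (Fin n))).tilted fun x => -(V x - s * G x) := by
  rw [tilted_tilted hZ]
  congr 1
  funext x
  simp only [Pi.add_apply]
  ring

end Tilt

/-! ## §2 On the window `|s| ≤ l₀`, `l₀M < λ`: the engine at modulus `λ − l₀M` for the tilted law -/
section Window

variable {V G : EuclideanSpace ℝ (Fin n) → ℝ} {lam M l₀ B L s : ℝ}

/-- **THE SCHEMA FOR THE TILTED LAW** [cite: BakryGentilLedoux2014, Cor. 5.7.2 — PROVED in the tree]: for `|s| ≤ l₀`, `l₀M < λ`, the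
source-tilted law `ν.tilted (s·G)` satisfies the `C¹_c` entropy schema with constant `1∕(λ − l₀M)`. -/
theorem entropyC1c_tilted_of_uniformlyConvex (hVc : ContDiff ℝ 1 V)
    (hV : ∀ x y : EuclideanSpace ℝ (Fin n), V x + ⟪gradient V x, y - x⟫ + lam / 2 * ‖y - x‖ ^ 2 ≤ V y)
    (hZ : Integrable fun x => Real.exp (-V x)) (hG : ContDiff ℝ 1 G) (hGb : ∀ x, |G x| ≤ B)
    (hGlo : ∀ x y : EuclideanSpace ℝ (Fin n), G x + ⟪gradient G x, y - x⟫ - M / 2 * ‖y - x‖ ^ 2 ≤ G y)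
    (hGup : ∀ x y : EuclideanSpace ℝ (Fin n), G y ≤ G x + ⟪gradient G x, y - x⟫ + M / 2 * ‖y - x‖ ^ 2) (hlM : l₀ * M < lam)
    (hs : |s| ≤ l₀) (φ : EuclideanSpace ℝ (Fin n) → ℝ) (hφ : ContDiff ℝ 1 φ) (hφs : HasCompactSupport φ) :
    ∫ x, φ x * Real.exp (φ x) ∂((volume.tilted fun x => -V x).tilted fun x => s * G x) -
        (∫ x, Real.exp (φ x) ∂((volume.tilted fun x => -V x).tilted fun x => s * G x)) *
          Real.log (∫ x, Real.exp (φ x) ∂((volume.tilted fun x => -V x).tilted fun x => s * G x)) ≤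
      (1 / (lam - l₀ * M)) / 2 *
        ∫ x, ‖fderiv ℝ φ x‖ ^ 2 * Real.exp (φ x) ∂((volume.tilted fun x => -V x).tilted fun x => s * G x) := by
  rw [tilted_mul_eq hZ s]
  exact entropyC1c_of_uniformlyConvex (sub_pos.2 hlM) (hVc.continuous.sub (continuous_const.mul hG.continuous))
    (firstOrder_sub_mul (hVc.differentiable one_ne_zero) (hG.differentiable one_ne_zero) hV hGlo hGup hs)
    (integrable_exp_neg_sub_mul hVc.continuous hG.continuous hGb hZ s) φ hφ hφs

/-- **SUB-GAUSSIAN UNDER THE TILTED LAW** [cite: BakryGentilLedoux2014, Prop. 5.4.1 + Cor. 5.7.2 — PROVED in the tree]: on the window, ANY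
`C¹` observable `F` with `|F| ≤ B′`, `‖DF‖ ≤ L′`, `L′ > 0` is sub-Gaussian about its `ν_s`-mean with parameter `L′²∕(λ − l₀M)` under
`ν_s = ν.tilted (s·G)`. -/
theorem hasSubgaussianMGF_tilted_of_uniformlyConvex {F : EuclideanSpace ℝ (Fin n) → ℝ} {B' L' : ℝ} (hVc : ContDiff ℝ 1 V)
    (hV : ∀ x y : EuclideanSpace ℝ (Fin n), V x + ⟪gradient V x, y - x⟫ + lam / 2 * ‖y - x‖ ^ 2 ≤ V y)
    (hZ : Integrable fun x => Real.exp (-V x)) (hG : ContDiff ℝ 1 G) (hGb : ∀ x, |G x| ≤ B)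
    (hGlo : ∀ x y : EuclideanSpace ℝ (Fin n), G x + ⟪gradient G x, y - x⟫ - M / 2 * ‖y - x‖ ^ 2 ≤ G y)
    (hGup : ∀ x y : EuclideanSpace ℝ (Fin n), G y ≤ G x + ⟪gradient G x, y - x⟫ + M / 2 * ‖y - x‖ ^ 2) (hlM : l₀ * M < lam)
    (hs : |s| ≤ l₀) (hF : ContDiff ℝ 1 F) (hFb : ∀ x, |F x| ≤ B') (hFD : ∀ x, ‖fderiv ℝ F x‖ ≤ L') (hL' : 0 < L') :
    HasSubgaussianMGF (fun x => F x - ∫ z, F z ∂((volume.tilted fun x => -V x).tilted fun x => s * G x))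
      ⟨L' ^ 2 / (lam - l₀ * M), by have := sub_pos.2 hlM; positivity⟩ ((volume.tilted fun x => -V x).tilted fun x => s * G x) := by
  rw [tilted_mul_eq hZ s]
  exact hasSubgaussianMGF_of_uniformlyConvex (sub_pos.2 hlM) (hVc.continuous.sub (continuous_const.mul hG.continuous))
    (firstOrder_sub_mul (hVc.differentiable one_ne_zero) (hG.differentiable one_ne_zero) hV hGlo hGup hs)
    (integrable_exp_neg_sub_mul hVc.continuous hG.continuous hGb hZ s) hF hFb hFD hL'

/-- **THE VARIANCE SOCKET'S LETTER FROM THE MODULUS** [cite: BrascampLieb1976, Thm 4.1 — PROVED in the tree].  On the window `|s| ≤ l₀`,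
`l₀M < λ`: `Var[G; ν.tilted (s·G)] ≤ (λ − l₀M)⁻¹·L²` for `ν = e^{−V}dx∕Z` — VERBATIM the tilted variance that
`…N14VarianceSocket.tiltedMeanMatching_of_variance` reads, bounded uniformly on the window (a BOUND, not the socket's matching; §3). -/
theorem variance_tilted_le_of_uniformlyConvex (hVc : ContDiff ℝ 1 V)
    (hV : ∀ x y : EuclideanSpace ℝ (Fin n), V x + ⟪gradient V x, y - x⟫ + lam / 2 * ‖y - x‖ ^ 2 ≤ V y)
    (hZ : Integrable fun x => Real.exp (-V x)) (hG : ContDiff ℝ 1 G) (hGb : ∀ x, |G x| ≤ B) (hGD : ∀ x, ‖fderiv ℝ G x‖ ≤ L)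
    (hGlo : ∀ x y : EuclideanSpace ℝ (Fin n), G x + ⟪gradient G x, y - x⟫ - M / 2 * ‖y - x‖ ^ 2 ≤ G y)
    (hGup : ∀ x y : EuclideanSpace ℝ (Fin n), G y ≤ G x + ⟪gradient G x, y - x⟫ + M / 2 * ‖y - x‖ ^ 2) (hlM : l₀ * M < lam)
    (hs : |s| ≤ l₀) :
    Var[G; (volume.tilted fun x => -V x).tilted fun x => s * G x] ≤ (lam - l₀ * M)⁻¹ * L ^ 2 := by
  rw [tilted_mul_eq hZ s]
  exact variance_le_of_uniformlyConvex (sub_pos.2 hlM) (hVc.continuous.sub (continuous_const.mul hG.continuous))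
    (firstOrder_sub_mul (hVc.differentiable one_ne_zero) (hG.differentiable one_ne_zero) hV hGlo hGup hs)
    (integrable_exp_neg_sub_mul hVc.continuous hG.continuous hGb hZ s) hG hGb hGD

/-- **THE SECOND DERIVATIVE OF THE BORN CUMULANT ON THE WINDOW** [folklore ∘ Mathlib `variance_tilted_mul`]: for `|s| ≤ l₀`, `l₀M < λ`,
`(cgf G ν)″(s) = Var[G; ν.tilted (s·G)] ≤ (λ − l₀M)⁻¹·L²` — the dressed action's curvature in the source bounded on the whole window by
the gradient constant (Taylor then gives `|cgf G ν t − t·∫G dν| ≤ (λ − l₀M)⁻¹L²·t²∕2` for `|t| ≤ l₀`, consistently with the engine). -/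
theorem iteratedDeriv_two_cgf_le_of_uniformlyConvex (hVc : ContDiff ℝ 1 V)
    (hV : ∀ x y : EuclideanSpace ℝ (Fin n), V x + ⟪gradient V x, y - x⟫ + lam / 2 * ‖y - x‖ ^ 2 ≤ V y)
    (hZ : Integrable fun x => Real.exp (-V x)) (hG : ContDiff ℝ 1 G) (hGb : ∀ x, |G x| ≤ B) (hGD : ∀ x, ‖fderiv ℝ G x‖ ≤ L)
    (hGlo : ∀ x y : EuclideanSpace ℝ (Fin n), G x + ⟪gradient G x, y - x⟫ - M / 2 * ‖y - x‖ ^ 2 ≤ G y)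
    (hGup : ∀ x y : EuclideanSpace ℝ (Fin n), G y ≤ G x + ⟪gradient G x, y - x⟫ + M / 2 * ‖y - x‖ ^ 2) (hlM : l₀ * M < lam)
    (hs : |s| ≤ l₀) :
    iteratedDeriv 2 (cgf G (volume.tilted fun x => -V x)) s ≤ (lam - l₀ * M)⁻¹ * L ^ 2 := by
  haveI : IsProbabilityMeasure ((volume : Measure (EuclideanSpace ℝ (Fin n))).tilted fun x => -V x) :=
    isProbabilityMeasure_tilted_neg hZ
  have hint : ∀ t : ℝ, Integrable (fun x => Real.exp (t * G x)) ((volume : Measure (EuclideanSpace ℝ (Fin n))).tilted fun x => -V x) :=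
    Literature.Probability.Moments.integrable_exp_mul_of_abs_le_const _ hG.continuous.measurable hGb
  have hmem : s ∈ interior (integrableExpSet G ((volume : Measure (EuclideanSpace ℝ (Fin n))).tilted fun x => -V x)) := by
    rw [(eq_univ_of_forall hint : integrableExpSet G _ = univ), interior_univ]
    exact mem_univ s
  rw [← variance_tilted_mul hmem]
  exact variance_tilted_le_of_uniformlyConvex hVc hV hZ hG hGb hGD hGlo hGup hlM hs

end Window

/-! ## §3 The socket plug: zero-tilt matching + UNIFORM tilted-variance bounds ⇒ `TiltedMeanMatching` (bounded, not summable) -/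
section Socket

variable {ι : Type*} [DecidableEq ι] {Ω Ω' : ℕ → Type*} [∀ K, MeasurableSpace (Ω K)] [∀ K, MeasurableSpace (Ω' K)]
  {l₀ B : ℝ} {T : ℕ → Finset ι} {Bad : ℕ → ℝ → Finset ι}
  {F : ∀ K, Ω K → ℝ} {ν : ∀ K, ι → Measure (Ω K)} {F' : ∀ K, Ω' K → ℝ} {ν' : ∀ K, ι → Measure (Ω' K)} {η₀ v : ℕ → ℝ}

/-- **THE SOCKET PLUG** [folklore].  Both runs' observables measurable with `|F K|, |F′ K| ≤ B`, class measures finite; ZERO-TILT mean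
matching within `η₀ K`; and both runs' tilted VARIANCES bounded by ONE `v K` on the window (`Var ≤ v K`, as §2 produces from a modulus).
Then `DressedMGFForm.TiltedMeanMatching l₀ T Bad F ν F′ ν′ (fun K => η₀ K + l₀·v K)` (generation 3's `tiltedMeanMatching_of_variance` with
`|Var′ − Var| ≤ v K`, two numbers of `[0, v K]`).  HONEST: `v K` from a modulus is a BOUND — the tilt part `l₀·v K` is summable only if `v` is; matching proper
(`|Var′ − Var|` small) is the per-bond engine's ∕ NODE O's. -/
theorem tiltedMeanMatching_of_variance_le (hFm : ∀ K, Measurable (F K)) (hF : ∀ K ω, |F K ω| ≤ B)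
    (hFm' : ∀ K, Measurable (F' K)) (hF' : ∀ K ω, |F' K ω| ≤ B) (hν : ∀ K, ∀ τ ∈ T K, IsFiniteMeasure (ν K τ))
    (hν' : ∀ K, ∀ τ ∈ T K, IsFiniteMeasure (ν' K τ))
    (h0 : ∀ K (t : ℝ), |t| ≤ l₀ → ∀ τ ∈ T K \ Bad K t, |tiltedMean (F' K) (ν' K τ) 0 - tiltedMean (F K) (ν K τ) 0| ≤ η₀ K)
    (hv : ∀ K (t : ℝ), |t| ≤ l₀ → ∀ τ ∈ T K \ Bad K t, ∀ s : ℝ, |s| ≤ l₀ → Var[F K; (ν K τ).tilted fun ω => s * F K ω] ≤ v K)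
    (hv' : ∀ K (t : ℝ), |t| ≤ l₀ → ∀ τ ∈ T K \ Bad K t, ∀ s : ℝ, |s| ≤ l₀ → Var[F' K; (ν' K τ).tilted fun ω => s * F' K ω] ≤ v K) :
    TiltedMeanMatching l₀ T Bad F ν F' ν' (fun K => η₀ K + l₀ * v K) :=
  YMDAG.N14.VarianceSocket.tiltedMeanMatching_of_variance hFm hF hFm' hF' hν hν' h0 fun K t ht τ hτ s hs => by
    have h1 := hv K t ht τ hτ s hs
    have h2 := hv' K t ht τ hτ s hs
    have h3 := variance_nonneg (F K) ((ν K τ).tilted fun ω => s * F K ω)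
    have h4 := variance_nonneg (F' K) ((ν' K τ).tilted fun ω => s * F' K ω)
    exact abs_sub_le_iff.2 ⟨by linarith, by linarith⟩

end Socket

section SocketConvex

variable {ι : Type*} [DecidableEq ι] {d d' : ℕ → ℕ} {T : ℕ → Finset ι} {Bad : ℕ → ℝ → Finset ι} {l₀ B lam M : ℝ} {L η₀ : ℕ → ℝ}
  {V : ∀ K, ι → EuclideanSpace ℝ (Fin (d K)) → ℝ} {G : ∀ K, EuclideanSpace ℝ (Fin (d K)) → ℝ}
  {V' : ∀ K, ι → EuclideanSpace ℝ (Fin (d' K)) → ℝ} {G' : ∀ K, EuclideanSpace ℝ (Fin (d' K)) → ℝ}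

/-- **THE SOCKET ON THE EUCLIDEAN TEMPLATE** [folklore ∘ §2].  Two runs of fibre laws `e^{−V K τ}dx∕Z` (dimensions `d K`, `d′ K`), every
action `C¹` and `λ`-uniformly convex, observables `G K`, `G′ K ∈ C¹` with `|·| ≤ B`, gradient sizes `≤ L K` and two-sided letter `M`,
`l₀M < λ`, zero-tilt matching `η₀`.  Then `TiltedMeanMatching l₀ T Bad G ν G′ ν′ (fun K => η₀ K + l₀·((λ − l₀M)⁻¹·(L K)²))`.  HONEST: the
tilt part is BOUNDED; it is summable iff `Σ (L K)² < ∞`, which the dressed totals of the tower of record do NOT satisfy — read §3's docstring. -/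
theorem tiltedMeanMatching_of_uniformlyConvex (hlM : l₀ * M < lam)
    (hVc : ∀ K τ, ContDiff ℝ 1 (V K τ)) (hVc' : ∀ K τ, ContDiff ℝ 1 (V' K τ))
    (hV : ∀ K τ (x y : EuclideanSpace ℝ (Fin (d K))), V K τ x + ⟪gradient (V K τ) x, y - x⟫ + lam / 2 * ‖y - x‖ ^ 2 ≤ V K τ y)
    (hV' : ∀ K τ (x y : EuclideanSpace ℝ (Fin (d' K))), V' K τ x + ⟪gradient (V' K τ) x, y - x⟫ + lam / 2 * ‖y - x‖ ^ 2 ≤ V' K τ y)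
    (hZ : ∀ K τ, Integrable fun x => Real.exp (-V K τ x)) (hZ' : ∀ K τ, Integrable fun x => Real.exp (-V' K τ x))
    (hG : ∀ K, ContDiff ℝ 1 (G K)) (hG' : ∀ K, ContDiff ℝ 1 (G' K)) (hGb : ∀ K x, |G K x| ≤ B) (hGb' : ∀ K x, |G' K x| ≤ B)
    (hGD : ∀ K x, ‖fderiv ℝ (G K) x‖ ≤ L K) (hGD' : ∀ K x, ‖fderiv ℝ (G' K) x‖ ≤ L K)
    (hGlo : ∀ K (x y : EuclideanSpace ℝ (Fin (d K))), G K x + ⟪gradient (G K) x, y - x⟫ - M / 2 * ‖y - x‖ ^ 2 ≤ G K y)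
    (hGup : ∀ K (x y : EuclideanSpace ℝ (Fin (d K))), G K y ≤ G K x + ⟪gradient (G K) x, y - x⟫ + M / 2 * ‖y - x‖ ^ 2)
    (hGlo' : ∀ K (x y : EuclideanSpace ℝ (Fin (d' K))), G' K x + ⟪gradient (G' K) x, y - x⟫ - M / 2 * ‖y - x‖ ^ 2 ≤ G' K y)
    (hGup' : ∀ K (x y : EuclideanSpace ℝ (Fin (d' K))), G' K y ≤ G' K x + ⟪gradient (G' K) x, y - x⟫ + M / 2 * ‖y - x‖ ^ 2)
    (h0 : ∀ K (t : ℝ), |t| ≤ l₀ → ∀ τ ∈ T K \ Bad K t,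
      |tiltedMean (G' K) ((volume : Measure (EuclideanSpace ℝ (Fin (d' K)))).tilted fun x => -V' K τ x) 0 -
        tiltedMean (G K) ((volume : Measure (EuclideanSpace ℝ (Fin (d K)))).tilted fun x => -V K τ x) 0| ≤ η₀ K) :
    TiltedMeanMatching l₀ T Bad G (fun K τ => (volume : Measure (EuclideanSpace ℝ (Fin (d K)))).tilted fun x => -V K τ x) G'
      (fun K τ => (volume : Measure (EuclideanSpace ℝ (Fin (d' K)))).tilted fun x => -V' K τ x)
      (fun K => η₀ K + l₀ * ((lam - l₀ * M)⁻¹ * L K ^ 2)) :=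
  tiltedMeanMatching_of_variance_le (fun K => (hG K).continuous.measurable) hGb (fun K => (hG' K).continuous.measurable) hGb'
    (fun _ _ _ => inferInstance) (fun _ _ _ => inferInstance) h0
    (fun K _ _ τ _ _ hs => variance_tilted_le_of_uniformlyConvex (hVc K τ) (hV K τ) (hZ K τ) (hG K) (hGb K) (hGD K) (hGlo K)
      (hGup K) hlM hs)
    (fun K _ _ τ _ _ hs => variance_tilted_le_of_uniformlyConvex (hVc' K τ) (hV' K τ) (hZ' K τ) (hG' K) (hGb' K) (hGD' K) (hGlo' K)
      (hGup' K) hlM hs)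

end SocketConvex

/-! ## §4 The tower in Herbst currency: conditionally sub-Gaussian born increments ⇒ K-uniform born cumulant -/
section Tower

variable {Ω : Type*} {mΩ : MeasurableSpace Ω} [StandardBorelSpace Ω] {μ : Measure Ω} [IsProbabilityMeasure μ]
  {ℱ : Filtration ℕ mΩ} {Y : ℕ → Ω → ℝ} {cY : ℕ → ℝ≥0} {a θ : ℝ}

/-- A geometric majorant of the parameters: `c_k ≤ a·θ^{2k}`, `0 ≤ θ < 1` ⇒ `Σ_{k<K} c_k ≤ a∕(1 − θ²)` for every `K`. [folklore] -/
theorem sum_le_geometric (ha : 0 ≤ a) (hθ0 : 0 ≤ θ) (hθ : θ < 1) (hc : ∀ k, (cY k : ℝ) ≤ a * θ ^ (2 * k)) (K : ℕ) :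
    ((∑ k ∈ range K, cY k : ℝ≥0) : ℝ) ≤ a / (1 - θ ^ 2) := by
  have hθ2 : θ ^ 2 < 1 := by nlinarith
  have hθ20 : 0 ≤ θ ^ 2 := sq_nonneg θ
  have hsum : Summable fun k : ℕ => a * (θ ^ 2) ^ k := (summable_geometric_of_lt_one hθ20 hθ2).mul_left a
  push_cast
  calc ∑ k ∈ range K, (cY k : ℝ) ≤ ∑ k ∈ range K, a * (θ ^ 2) ^ k :=
        sum_le_sum fun k _ => by rw [← pow_mul]; exact hc k
    _ ≤ ∑' k, a * (θ ^ 2) ^ k := hsum.sum_le_tsum (range K) (fun k _ => by positivity)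
    _ = a / (1 - θ ^ 2) := by rw [tsum_mul_left, tsum_geometric_of_lt_one hθ20 hθ2, div_eq_mul_inv]

/-- **THE CENTRED DRESSED TOTAL IS SUB-GAUSSIAN, K-UNIFORMLY** [folklore ∘ Mathlib `HasSubgaussianMGF.sum_of_hasCondSubgaussianMGF`].  Along a
filtration `ℱ`, born increments `Y k` strongly adapted, `Y 0` sub-Gaussian with `c₀` and `Y (k+1)` CONDITIONALLY sub-Gaussian given `ℱ k`
with `c_{k+1}`, the parameters geometrically majorised `c_k ≤ a·θ^{2k}` (`0 ≤ θ < 1`): the sum `Σ_{k<K} Y k` is sub-Gaussian with the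
K-FREE parameter `a∕(1 − θ²)` (the monotonicity `hasSubgaussianMGF_mono` is the tree's, `B1Eq357FluctuationPolynomial`). -/
theorem hasSubgaussianMGF_sum_geometric (h_adapted : StronglyAdapted ℱ Y) (h0 : HasSubgaussianMGF (Y 0) (cY 0) μ)
    (h_subG : ∀ k, HasCondSubgaussianMGF (ℱ k) (ℱ.le k) (Y (k + 1)) (cY (k + 1)) μ) (ha : 0 ≤ a) (hθ0 : 0 ≤ θ) (hθ : θ < 1)
    (hc : ∀ k, (cY k : ℝ) ≤ a * θ ^ (2 * k)) (K : ℕ) :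
    HasSubgaussianMGF (fun ω => ∑ k ∈ range K, Y k ω) ⟨a / (1 - θ ^ 2), div_nonneg ha (by nlinarith)⟩ μ := by
  have h := HasSubgaussianMGF.sum_of_hasCondSubgaussianMGF h_adapted h0 K fun i _ => h_subG i
  refine hasSubgaussianMGF_mono h ?_
  rw [← NNReal.coe_le_coe]
  exact sum_le_geometric ha hθ0 hθ hc K

/-- **DRESSED STABILITY OF THE COUPLED TOWER IN HERBST CURRENCY** [folklore].  If the dressed total `F` at depth `K` decomposes as its
mean plus the born increments, `F − ∫F dμ = Σ_{k<K} Y k`, with the increments as in `hasSubgaussianMGF_sum_geometric`, then the born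
cumulant obeys `cgf F μ t − t·∫F dμ ≤ (a∕(1 − θ²))·t²∕2` for every real `t` — UNIFORMLY IN `K` (generation 3's
`bornCumulant_le_of_hasSubgaussianMGF`).  With `c_k = (L₀θ₁^k)²∕λ′` from `…ConvexFibreEngine` fibre by fibre this is NE1′'s dressed
stability mechanism in gradient currency: young rate squared, summed. -/
theorem bornCumulant_le_of_tower {F : Ω → ℝ} (h_adapted : StronglyAdapted ℱ Y) (h0 : HasSubgaussianMGF (Y 0) (cY 0) μ)
    (h_subG : ∀ k, HasCondSubgaussianMGF (ℱ k) (ℱ.le k) (Y (k + 1)) (cY (k + 1)) μ) (ha : 0 ≤ a) (hθ0 : 0 ≤ θ) (hθ : θ < 1)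
    (hc : ∀ k, (cY k : ℝ) ≤ a * θ ^ (2 * k)) {K : ℕ} (hF : ∀ ω, F ω - ∫ z, F z ∂μ = ∑ k ∈ range K, Y k ω) (t : ℝ) :
    cgf F μ t - t * ∫ z, F z ∂μ ≤ a / (1 - θ ^ 2) * t ^ 2 / 2 := by
  have h := hasSubgaussianMGF_sum_geometric h_adapted h0 h_subG ha hθ0 hθ hc K
  have h' : HasSubgaussianMGF (fun ω => F ω - ∫ z, F z ∂μ) ⟨a / (1 - θ ^ 2), div_nonneg ha (by nlinarith)⟩ μ :=
    h.congr (Eventually.of_forall fun ω => (hF ω).symm)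
  have hb := bornCumulant_le_of_hasSubgaussianMGF h' t
  exact_mod_cast hb

end Tower

end YMDAG.N14.ConvexFibreWindow

end
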